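import Literature.AlgebraicGeometry.Motives.HodgeThetaSubalgebraUnitaryRaisingSpaceSpan
import Literature.AlgebraicGeometry.Motives.HodgeThetaSubalgebraUnitaryInvertiblePencil
import HarnessLib

/-!
# Raising-space dimension through a Levi pair: the number of independent raising operators of a constant-rank
# algebra is one more than that of its Levi centraliser, and a full Levi algebra of type `(p | q)` has `pq` of them
# (Ribet 1983 Thm. 3, Lie step — TOOL I of the minimal-rank method)

Family `hodge`, layer `Literature/AlgebraicGeometry/Motives` (pure linear algebra over `ℂ`; no geometry). Research
context: cell `pub-hodge-ring2` (HONEST FRAMING: research route conditional on HC_CM; not a corollary; Q11.4-sentence-2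
already refuted in dim ≥ 3), Literature lane gen 90. UNCONDITIONAL; theorems only, no definition, no named fact
(D-0026), no `sorry`. Sequel of `HodgeThetaSubalgebraUnitaryRaisingSpaceSpan` (A(k), B(k), transfer) and
`HodgeThetaSubalgebraUnitaryInvertiblePencil`.

THE SETTING is that of the tree's unitary cores (Gordon's sketch of Ribet's proof, held `paper:arxiv-alg-geom_9709030`
pp. 18–19, run infinitesimally): `𝔊 ⊆ End_ℂ(W)` bracket-closed, an involution `Θ ∈ 𝔊` with eigenspaces `P`, `Q`, a
raising `B ∈ 𝔊` (`ΘB = B = −BΘ`) with its Levi involution `ι ∈ 𝔊` (`UnitaryLeviSetup.exists_levi_pair`):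
`U⁺ = {ι = 1} ⊇ QU = Q ∩ U⁺`, `U⁻ = {ι = −1} ⊇ B(W)`, and the Levi algebras `L^± = 𝔷(ι)|_{U^±}`. «Spanned by `k`
raising operators» is expressed, as in the tree's A(k)/B(k) files, by a family `Fin k → End` of raising elements whose
span contains every raising element — no definition is introduced.

PROVED HERE (the GLOBAL invariant asked for by the `(28 | 51)` cell of `p = 79`, where the minimal-rank method is
locally consistent all the way down — `pub-hodge-ring2-lit-g89/README.md` §HEIRS):
* §1 `UnitaryRaisingDim.exists_fin_span_commute_of_span` — a family spanning the raising operators of `𝔊` yields one of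
  the same size spanning the raising operators commuting with `ι` (`Y ↦ ½(Y + ιYι)`).
* §2 `UnitaryRaisingDim.exists_fin_span_levi_of_commute` — a family spanning the raising operators of `𝔊` commuting
  with `ι` restricts to one spanning the raising elements of the Levi algebra on ANY `ι`-stable `U` (every raising
  element lifts, `UnitaryLeviSetup.exists_lift_eq`); `UnitaryRaisingDim.exists_fin_span_commute_of_levi` — conversely, a
  family spanning the raising elements of the Levi algebra on `U` lifts to one spanning the raising operators commuting
  with `ι`, PROVIDED every such operator vanishing on `U` vanishes on a complement `U'` (the «no profile `(0, j)`» rule of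
  the cells; this is the inner step of `UnitaryLeviSetup.exists_fin_span_transfer`).
* §3 **`UnitaryRaisingDim.exists_fin_span_raise_of_constRank`** — if every non-zero raising operator of `𝔊` has the rank
  of `B` («constant rank»), then `B` together with a family spanning the raising operators commuting with `ι` spans ALL
  raising operators: `Y = ½(Y + ιYι) + π₋Yπ₊ + π₊Yπ₋` with `π₊Yπ₋ = 0` (else `B + π₊Yπ₋` has rank `rk B + rk π₊Yπ₋`) and
  `π₋Yπ₊ ∈ ℂB` (an invertible pencil on the slot `QU → B(W)`, `UnitaryInvertiblePencil.exists_eq_smul_on`).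
* §4 `UnitaryRaisingDim.false_of_fin_span_of_top` — a FULL Levi algebra `L = End(U)` of type `(p | q)` is not spanned
  by fewer than `pq` raising elements (`f ↦ ι_P ∘ f ∘ π_Q` embeds `Hom(Q_U, P_U)`, of dimension `pq`
  (`Module.finrank_linearMap`), into the raising elements); `UnitaryRaisingDim.exists_fin_span_pad` — padding.
USE (the «dimension transfer» endgame of the cells): at a minimal base point with constant profile `(i, j)`, `i, j > 0`,
an upper bound `u` for the raising elements of `L⁻` (obtained recursively from §3 and A(k)) transfers through §2 to `L⁺`,
where a full small Levi algebra and §4 (or a recursive lower bound) refute it.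

## References
* [Ribet1983] K. A. Ribet, *Hodge classes on certain types of abelian varieties*, Amer. J. Math. 105 (1983), Thm. 3
  (= [Gordon1997, Thm. 6.3 (3)], held `paper:arxiv-alg-geom_9709030` pp. 18–19).
* [Gordon1997] B. B. Gordon, *A survey of the Hodge conjecture for abelian varieties*, arXiv:alg-geom/9709030, §6.
* [Deligne1982HodgeCycles] P. Deligne, *Hodge cycles on abelian varieties*, LNM 900 (1982), I §3 Prop. 3.4, 3.6.
* [GoodmanWallachGTM255] R. Goodman, N. R. Wallach, GTM 255 (2009), §4.1.1 (gradings, centralisers of involutions).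
* [HoffmanKunze1971LinearAlgebra] K. Hoffman, R. Kunze, *Linear Algebra* (1971), §3.1 Thm. 2, §6.2 Thm. 1, §6.7.
-/

noncomputable section

namespace Literature.AlgebraicGeometry.Motives

namespace HodgeStructure

universe u

variable {W : Type u} [AddCommGroup W] [Module ℂ W]

/-! ### §1 From all raising operators to those commuting with `ι` -/

/-- `ιYι ∈ 𝔊` for `Y ∈ 𝔊` and an involution `ι ∈ 𝔊` of the bracket-closed `𝔊`:
`[ι,[ι,Y]] = 2Y − 2ιYι`. [cite: GoodmanWallachGTM255, §4.1.1] -/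
theorem UnitaryRaisingDim.conj_mem {𝔊 : Submodule ℂ (Module.End ℂ W)}
    (hbr : ∀ Y ∈ 𝔊, ∀ Z ∈ 𝔊, Y * Z - Z * Y ∈ 𝔊) {ι : Module.End ℂ W} (hι : ι ∈ 𝔊) (hιι : ι * ι = 1)
    {Y : Module.End ℂ W} (hY : Y ∈ 𝔊) : ι * Y * ι ∈ 𝔊 := by
  have h1 : ι * Y - Y * ι ∈ 𝔊 := hbr ι hι Y hY
  have h2 : ι * (ι * Y - Y * ι) - (ι * Y - Y * ι) * ι ∈ 𝔊 := hbr ι hι _ h1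
  have h2' : ι * (ι * Y - Y * ι) - (ι * Y - Y * ι) * ι = (2 : ℂ) • Y - (2 : ℂ) • (ι * Y * ι) := by
    rw [mul_sub, sub_mul, ← mul_assoc, hιι, one_mul, mul_assoc Y ι ι, hιι, mul_one, ← mul_assoc]
    module
  rw [h2'] at h2
  have h3 : (2 : ℂ) • (ι * Y * ι) = (2 : ℂ) • Y - ((2 : ℂ) • Y - (2 : ℂ) • (ι * Y * ι)) := by module
  have h4 : (2 : ℂ) • (ι * Y * ι) ∈ 𝔊 := by
    rw [h3]; exact Submodule.sub_mem _ (Submodule.smul_mem _ _ hY) h2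
  have h5 : ι * Y * ι = (2 : ℂ)⁻¹ • ((2 : ℂ) • (ι * Y * ι)) := by
    rw [smul_smul, inv_mul_cancel₀ two_ne_zero, one_smul]
  rw [h5]; exact Submodule.smul_mem _ _ h4

/-- **Projection to the centraliser.** If raising operators `F₀, …, F_{k−1} ∈ 𝔊` span the raising operators of `𝔊`,
then the raising operators `½(Fᵢ + ιFᵢι)`, which commute with `ι`, span the raising operators of `𝔊` commuting with `ι`
(for such `X`, `X = ½(X + ιXι)`). [cite: GoodmanWallachGTM255, §4.1.1] [cite: HoffmanKunze1971LinearAlgebra, §6.7] -/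
theorem UnitaryRaisingDim.exists_fin_span_commute_of_span {𝔊 : Submodule ℂ (Module.End ℂ W)}
    (hbr : ∀ Y ∈ 𝔊, ∀ Z ∈ 𝔊, Y * Z - Z * Y ∈ 𝔊) {Θ : Module.End ℂ W}
    {ι : Module.End ℂ W} (hι : ι ∈ 𝔊) (hιι : ι * ι = 1) (hιΘ : ι * Θ = Θ * ι)
    {k : ℕ} {F : Fin k → Module.End ℂ W} (hF : ∀ i, F i ∈ 𝔊 ∧ Θ * F i = F i ∧ F i * Θ = -(F i))
    (hspan : ∀ Y ∈ 𝔊, Θ * Y = Y → Y * Θ = -Y → Y ∈ Submodule.span ℂ (Set.range F)) :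
    ∃ G : Fin k → Module.End ℂ W, (∀ i, G i ∈ 𝔊 ∧ Θ * G i = G i ∧ G i * Θ = -(G i) ∧ G i * ι = ι * G i) ∧
      ∀ X ∈ 𝔊, Θ * X = X → X * Θ = -X → X * ι = ι * X → X ∈ Submodule.span ℂ (Set.range G) := by
  classical
  refine ⟨fun i => (2 : ℂ)⁻¹ • (F i + ι * F i * ι), fun i => ⟨?_, ?_, ?_, ?_⟩, fun X hX hΘX hXΘ hXc => ?_⟩
  · exact Submodule.smul_mem _ _ (Submodule.add_mem _ (hF i).1 (UnitaryRaisingDim.conj_mem hbr hι hιι (hF i).1))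
  · show Θ * ((2 : ℂ)⁻¹ • (F i + ι * F i * ι)) = (2 : ℂ)⁻¹ • (F i + ι * F i * ι)
    rw [mul_smul_comm, mul_add, (hF i).2.1, show Θ * (ι * F i * ι) = ι * F i * ι by
      rw [← mul_assoc, ← mul_assoc, ← hιΘ, mul_assoc ι Θ (F i), (hF i).2.1]]
  · show ((2 : ℂ)⁻¹ • (F i + ι * F i * ι)) * Θ = -((2 : ℂ)⁻¹ • (F i + ι * F i * ι))
    rw [smul_mul_assoc, add_mul, (hF i).2.2, show ι * F i * ι * Θ = -(ι * F i * ι) by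
      rw [mul_assoc, hιΘ, ← mul_assoc, mul_assoc ι (F i) Θ, (hF i).2.2, mul_neg, neg_mul], ← neg_add, smul_neg]
  · show ((2 : ℂ)⁻¹ • (F i + ι * F i * ι)) * ι = ι * ((2 : ℂ)⁻¹ • (F i + ι * F i * ι))
    rw [smul_mul_assoc, mul_smul_comm, add_mul, mul_add, show ι * F i * ι * ι = ι * F i by
      rw [mul_assoc, hιι, mul_one], show ι * (ι * F i * ι) = F i * ι by
      rw [← mul_assoc, ← mul_assoc, hιι, one_mul], add_comm]
  · obtain ⟨c, hc⟩ := (Submodule.mem_span_range_iff_exists_fun ℂ).1 (hspan X hX hΘX hXΘ)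
    have hXX : X = (2 : ℂ)⁻¹ • (X + ι * X * ι) := by
      rw [mul_assoc, hXc, ← mul_assoc, hιι, one_mul, ← two_smul ℂ X, smul_smul, inv_mul_cancel₀ two_ne_zero,
        one_smul]
    have hsum : (2 : ℂ)⁻¹ • (X + ι * X * ι) = ∑ i, c i • ((2 : ℂ)⁻¹ • (F i + ι * F i * ι)) := by
      rw [← hc, Finset.mul_sum, Finset.sum_mul, ← Finset.sum_add_distrib, Finset.smul_sum]
      refine Finset.sum_congr rfl fun i _ => ?_
      rw [mul_smul_comm, smul_mul_assoc, ← smul_add, smul_comm]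
    rw [hXX, hsum]
    exact Submodule.sum_mem _ fun i _ => Submodule.smul_mem _ _ (Submodule.subset_span ⟨i, rfl⟩)

/-! ### §2 Between the centraliser of `ι` and the Levi algebra on an `ι`-stable subspace -/

/-- **Restriction of a spanning family.** If raising operators `G₀, …, G_{k−1} ∈ 𝔊` commuting with `ι` span the raising
operators of `𝔊` commuting with `ι`, their restrictions to an `ι`-stable `U` span the raising elements of the Levi
algebra `L = 𝔷(ι)|_U` (each of which lifts, `UnitaryLeviSetup.exists_lift_eq`). [cite: GoodmanWallachGTM255, §4.1.1]
[cite: Deligne1982HodgeCycles, I §3 Prop. 3.4] [cite: HoffmanKunze1971LinearAlgebra, §3.1 Thm. 2] -/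
theorem UnitaryRaisingDim.exists_fin_span_levi_of_commute [FiniteDimensional ℂ W] {𝔊 : Submodule ℂ (Module.End ℂ W)}
    (hbr : ∀ Y ∈ 𝔊, ∀ Z ∈ 𝔊, Y * Z - Z * Y ∈ 𝔊) {Θ : Module.End ℂ W} (hΘ : Θ ∈ 𝔊) (hΘΘ : Θ * Θ = 1)
    {ι : Module.End ℂ W} {U : Submodule ℂ W} {L : Submodule ℂ (Module.End ℂ U)} {ιU : Module.End ℂ U}
    (hcU : ∀ Z : Module.End ℂ W, Z * ι = ι * Z → ∀ x ∈ U, Z x ∈ U) (hιΘ : ι * Θ = Θ * ι)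
    (hL : ∀ A, A ∈ L ↔ ∃ Z ∈ 𝔊, Z * ι = ι * Z ∧ ∀ x : U, ((A x : U) : W) = Z x)
    (hιU : ∀ x : U, ((ιU x : U) : W) = Θ x)
    {k : ℕ} {G : Fin k → Module.End ℂ W}
    (hG : ∀ i, G i ∈ 𝔊 ∧ Θ * G i = G i ∧ G i * Θ = -(G i) ∧ G i * ι = ι * G i)
    (hspan : ∀ X ∈ 𝔊, Θ * X = X → X * Θ = -X → X * ι = ι * X → X ∈ Submodule.span ℂ (Set.range G)) :
    ∃ F : Fin k → Module.End ℂ U, (∀ i, F i ∈ L ∧ ιU * F i = F i ∧ F i * ιU = -(F i)) ∧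
      ∀ A ∈ L, ιU * A = A → A * ιU = -A → A ∈ Submodule.span ℂ (Set.range F) := by
  classical
  refine ⟨fun i => (G i).restrict (hcU (G i) (hG i).2.2.2), fun i => ?_, fun A hA hιA hAι => ?_⟩
  · obtain ⟨h1, h2, h3, -⟩ :=
      UnitaryLeviSetup.restrict_mem hcU hL hιU (G i) (hG i).1 (hG i).2.1 (hG i).2.2.1 (hG i).2.2.2
    exact ⟨h1, h2, h3⟩
  obtain ⟨X, hX, hΘX, hXΘ, hXc, hXv⟩ := UnitaryLeviSetup.exists_lift_eq hbr hΘ hΘΘ hιΘ hL hιU A hA hιA hAι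
  obtain ⟨c, hc⟩ := (Submodule.mem_span_range_iff_exists_fun ℂ).1 (hspan X hX hΘX hXΘ hXc)
  have hAeq : A = ∑ i, c i • (G i).restrict (hcU (G i) (hG i).2.2.2) := by
    refine LinearMap.ext fun v => Subtype.ext ?_
    rw [← hXv v, ← hc]
    simp only [LinearMap.sum_apply, LinearMap.smul_apply, Submodule.coe_sum, Submodule.coe_smul,
      LinearMap.coe_restrict_apply]
  rw [hAeq]
  exact Submodule.sum_mem _ fun i _ => Submodule.smul_mem _ _ (Submodule.subset_span ⟨i, rfl⟩)

/-- **Lift of a spanning family.** Let `U`, `U'` be `ι`-stable with `U + U' = W`, and suppose every raising operator of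
`𝔊` commuting with `ι` that vanishes on `U` vanishes on `U'` (no profile `(0, j)`, `j ≠ 0`). If raising elements
`F₀, …, F_{k−1}` of the Levi algebra `L = 𝔷(ι)|_U` span its raising elements, then their lifts span the raising
operators of `𝔊` commuting with `ι`. [cite: GoodmanWallachGTM255, §4.1.1] [cite: Deligne1982HodgeCycles, I §3 Prop. 3.4, 3.6]
[cite: HoffmanKunze1971LinearAlgebra, §3.1 Thm. 2] -/
theorem UnitaryRaisingDim.exists_fin_span_commute_of_levi [FiniteDimensional ℂ W] {𝔊 : Submodule ℂ (Module.End ℂ W)}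
    (hbr : ∀ Y ∈ 𝔊, ∀ Z ∈ 𝔊, Y * Z - Z * Y ∈ 𝔊) {Θ : Module.End ℂ W} (hΘ : Θ ∈ 𝔊) (hΘΘ : Θ * Θ = 1)
    {ι : Module.End ℂ W} {U U' : Submodule ℂ W} {L : Submodule ℂ (Module.End ℂ U)} {ιU : Module.End ℂ U}
    (hcU : ∀ Z : Module.End ℂ W, Z * ι = ι * Z → ∀ x ∈ U, Z x ∈ U) (hιΘ : ι * Θ = Θ * ι)
    (hL : ∀ A, A ∈ L ↔ ∃ Z ∈ 𝔊, Z * ι = ι * Z ∧ ∀ x : U, ((A x : U) : W) = Z x)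
    (hιU : ∀ x : U, ((ιU x : U) : W) = Θ x)
    (hUU' : ∀ w : W, ∃ u ∈ U, ∃ u' ∈ U', w = u + u')
    (hrule : ∀ X ∈ 𝔊, Θ * X = X → X * Θ = -X → X * ι = ι * X → (∀ v ∈ U, X v = 0) → ∀ v ∈ U', X v = 0)
    {k : ℕ} {F : Fin k → Module.End ℂ U} (hF : ∀ i, F i ∈ L ∧ ιU * F i = F i ∧ F i * ιU = -(F i))
    (hspan : ∀ A ∈ L, ιU * A = A → A * ιU = -A → A ∈ Submodule.span ℂ (Set.range F)) :
    ∃ G : Fin k → Module.End ℂ W, (∀ i, G i ∈ 𝔊 ∧ Θ * G i = G i ∧ G i * Θ = -(G i) ∧ G i * ι = ι * G i) ∧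
      ∀ X ∈ 𝔊, Θ * X = X → X * Θ = -X → X * ι = ι * X → X ∈ Submodule.span ℂ (Set.range G) := by
  classical
  have hlift : ∀ i, ∃ X ∈ 𝔊, Θ * X = X ∧ X * Θ = -X ∧ X * ι = ι * X ∧ ∀ v : U, X v = ((F i v : U) : W) :=
    fun i => UnitaryLeviSetup.exists_lift_eq hbr hΘ hΘΘ hιΘ hL hιU (F i) (hF i).1 (hF i).2.1 (hF i).2.2
  choose G hG hΘG hGΘ hGc hGv using hlift
  refine ⟨G, fun i => ⟨hG i, hΘG i, hGΘ i, hGc i⟩, fun X hX hΘX hXΘ hXc => ?_⟩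
  obtain ⟨hxmem, hιx, hxι, -⟩ := UnitaryLeviSetup.restrict_mem hcU hL hιU X hX hΘX hXΘ hXc
  obtain ⟨c, hc⟩ := (Submodule.mem_span_range_iff_exists_fun ℂ).1 (hspan _ hxmem hιx hxι)
  -- `D = X − Σ cᵢ Gᵢ` vanishes on `U`, hence on `U'`, hence everywhere
  set S : Module.End ℂ W := ∑ i, c i • G i with hSdef
  have hSmem : S ∈ 𝔊 := Submodule.sum_mem _ fun i _ => Submodule.smul_mem _ _ (hG i)
  have hΘS : Θ * S = S := by
    rw [hSdef, Finset.mul_sum]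
    exact Finset.sum_congr rfl fun i _ => by rw [mul_smul_comm, hΘG i]
  have hSΘ : S * Θ = -S := by
    rw [hSdef, Finset.sum_mul, ← Finset.sum_neg_distrib]
    exact Finset.sum_congr rfl fun i _ => by rw [smul_mul_assoc, hGΘ i, smul_neg]
  have hSc : S * ι = ι * S := by
    rw [hSdef, Finset.sum_mul, Finset.mul_sum]
    exact Finset.sum_congr rfl fun i _ => by rw [smul_mul_assoc, mul_smul_comm, hGc i]
  have hDU : ∀ v ∈ U, (X - S) v = 0 := by
    intro v hv
    have h1 : X v = ((X.restrict (hcU X hXc) ⟨v, hv⟩ : U) : W) := rfl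
    rw [LinearMap.sub_apply, h1, ← hc, hSdef]
    simp only [LinearMap.sum_apply, LinearMap.smul_apply, Submodule.coe_sum, Submodule.coe_smul, ← hGv,
      sub_self]
  have hDU' : ∀ v ∈ U', (X - S) v = 0 :=
    hrule (X - S) (Submodule.sub_mem _ hX hSmem) (by rw [mul_sub, hΘX, hΘS]) (by rw [sub_mul, hXΘ, hSΘ, neg_sub'])
      (by rw [sub_mul, mul_sub, hXc, hSc]) hDU
  have hD0 : X - S = 0 := by
    refine LinearMap.ext fun w => ?_
    obtain ⟨u, hu, u', hu', rfl⟩ := hUU' w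
    rw [map_add, hDU u hu, hDU' u' hu', add_zero, LinearMap.zero_apply]
  have hXS : X = S := sub_eq_zero.1 hD0
  rw [hXS, hSdef]
  exact Submodule.sum_mem _ fun i _ => Submodule.smul_mem _ _ (Submodule.subset_span ⟨i, rfl⟩)

/-! ### §3 Constant rank: `B` and the centraliser span everything -/

/-- **Constant-rank dimension step.** Let `B ∈ 𝔊` be a non-zero raising operator with Levi involution `ι`
(`B(W) = {ι = −1, Θ = 1}`, `Q ∩ ker B = {ι = −1, Θ = −1}`, `QU = {ι = 1, Θ = −1}`, `dim QU = rk B`), and suppose every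
non-zero raising operator of `𝔊` has rank `rk B`. If raising operators `G₀, …, G_{k−1}` commuting with `ι` span the raising
operators of `𝔊` commuting with `ι`, then `B, G₀, …, G_{k−1}` span ALL raising operators of `𝔊`: for a raising `Y`,
`Y = ½(Y + ιYι) + π₋Yπ₊ + π₊Yπ₋` (`π_± = ½(1 ± ι)`; the three pieces lie in `𝔊`, `UnitaryTheta.raise_mem`), where
`π₊Yπ₋ = 0` — `B + π₊Yπ₋` is a raising operator of rank `rk B + rk π₊Yπ₋` — and `π₋Yπ₊ ∈ ℂB` — the raising operators
supported on the slot `QU → B(W)` are `0` or injective on `QU`, an invertible pencil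
(`UnitaryInvertiblePencil.exists_eq_smul_on`). [cite: Ribet1983, Thm. 3] [cite: Gordon1997, §6 (proof of Thm. 6.3.3, p. 19)]
[cite: GoodmanWallachGTM255, §4.1.1] [cite: HoffmanKunze1971LinearAlgebra, §6.2 Thm. 1, §6.7] -/
theorem UnitaryRaisingDim.exists_fin_span_raise_of_constRank [FiniteDimensional ℂ W]
    {𝔊 : Submodule ℂ (Module.End ℂ W)} (hbr : ∀ Y ∈ 𝔊, ∀ Z ∈ 𝔊, Y * Z - Z * Y ∈ 𝔊)
    {Θ : Module.End ℂ W} (hΘΘ : Θ * Θ = 1) {Q : Submodule ℂ W} (hQ : ∀ x, x ∈ Q ↔ Θ x = -x)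
    {B : Module.End ℂ W} (hB : B ∈ 𝔊) (hΘB : Θ * B = B) (hBΘ : B * Θ = -B)
    (hr0 : 0 < Module.finrank ℂ (LinearMap.range B))
    (hS : ∀ Y ∈ 𝔊, Θ * Y = Y → Y * Θ = -Y → Module.finrank ℂ (LinearMap.range Y) = 0 ∨
      Module.finrank ℂ (LinearMap.range Y) = Module.finrank ℂ (LinearMap.range B))
    {ι : Module.End ℂ W} (hι : ι ∈ 𝔊) (hιι : ι * ι = 1) (hιΘ : ι * Θ = Θ * ι) {QU : Submodule ℂ W}
    (hPM : ∀ x, x ∈ LinearMap.range B ↔ ι x = -x ∧ Θ x = x)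
    (hQM : ∀ x, x ∈ Q ⊓ LinearMap.ker B ↔ ι x = -x ∧ Θ x = -x)
    (hQU : ∀ x, x ∈ QU ↔ ι x = x ∧ Θ x = -x)
    (hfinQU : Module.finrank ℂ QU = Module.finrank ℂ (LinearMap.range B))
    {k : ℕ} {G : Fin k → Module.End ℂ W}
    (hG : ∀ i, G i ∈ 𝔊 ∧ Θ * G i = G i ∧ G i * Θ = -(G i) ∧ G i * ι = ι * G i)
    (hspan : ∀ X ∈ 𝔊, Θ * X = X → X * Θ = -X → X * ι = ι * X → X ∈ Submodule.span ℂ (Set.range G)) :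
    ∃ F : Fin (k + 1) → Module.End ℂ W, (∀ i, F i ∈ 𝔊 ∧ Θ * F i = F i ∧ F i * Θ = -(F i)) ∧
      ∀ Y ∈ 𝔊, Θ * Y = Y → Y * Θ = -Y → Y ∈ Submodule.span ℂ (Set.range F) := by
  classical
  have hΘΘv : ∀ v, Θ (Θ v) = v := fun v => by rw [← Module.End.mul_apply, hΘΘ, Module.End.one_apply]
  have hιιv : ∀ v, ι (ι v) = v := fun v => by rw [← Module.End.mul_apply, hιι, Module.End.one_apply]
  have htwo : ∀ x : W, x = -x → x = 0 := fun x hx => by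
    have h2 : (2 : ℂ) • x = 0 := by rw [two_smul]; nth_rw 2 [hx]; exact add_neg_cancel x
    exact (smul_eq_zero.1 h2).resolve_left two_ne_zero
  -- raising operators kill the `Θ`-fixed vectors
  have hkillP : ∀ Z : Module.End ℂ W, Z * Θ = -Z → ∀ x, Θ x = x → Z x = 0 := fun Z hZΘ x hx => by
    refine htwo _ ?_
    have h := congrArg (fun T => T x) hZΘ
    simp only [Module.End.mul_apply, LinearMap.neg_apply, hx] at h
    exact h
  -- the `QU`-part of a vector, through which every raising operator `Z` with `Zι = Z` factors
  have hQUpart : ∀ w, (2 : ℂ)⁻¹ • ((2 : ℂ)⁻¹ • (w + ι w) - Θ ((2 : ℂ)⁻¹ • (w + ι w))) ∈ QU := fun w => by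
    refine (hQU _).2 ⟨?_, ?_⟩
    · have hιΘv : ∀ v, ι (Θ v) = Θ (ι v) := fun v => by rw [← Module.End.mul_apply, hιΘ, Module.End.mul_apply]
      simp only [map_smul, map_sub, map_add, hιιv, hιΘv]
      module
    · simp only [map_smul, map_sub, map_add, hΘΘv]
      module
  have hfactor : ∀ Z : Module.End ℂ W, Z * Θ = -Z → Z * ι = Z → ∀ w,
      Z w = Z ((2 : ℂ)⁻¹ • ((2 : ℂ)⁻¹ • (w + ι w) - Θ ((2 : ℂ)⁻¹ • (w + ι w)))) := fun Z hZΘ hZι w => by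
    have hZιv : Z (ι w) = Z w := by rw [← Module.End.mul_apply, hZι]
    have hu : Z ((2 : ℂ)⁻¹ • (w + ι w)) = Z w := by
      rw [map_smul, map_add, hZιv, ← two_smul ℂ (Z w), smul_smul, inv_mul_cancel₀ two_ne_zero, one_smul]
    set u : W := (2 : ℂ)⁻¹ • (w + ι w) with hudef
    have hfix : Θ ((2 : ℂ)⁻¹ • (u + Θ u)) = (2 : ℂ)⁻¹ • (u + Θ u) := by
      rw [map_smul, map_add, hΘΘv, add_comm]
    have hsplit : u = (2 : ℂ)⁻¹ • (u + Θ u) + (2 : ℂ)⁻¹ • (u - Θ u) := by module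
    rw [← hu]
    conv_lhs => rw [hsplit]
    rw [map_add, hkillP Z hZΘ _ hfix, zero_add]
  -- `B` is supported on the slot: `ιB = −B`, `Bι = B`
  have hιB : ι * B = -B := LinearMap.ext fun w => by
    rw [Module.End.mul_apply, LinearMap.neg_apply]
    exact ((hPM (B w)).1 ⟨w, rfl⟩).1
  have hBι : B * ι = B := by
    refine LinearMap.ext fun w => ?_
    rw [Module.End.mul_apply]
    -- `u = w − ιw ∈ U⁻ = B(W) ⊕ (Q ∩ ker B)` is killed by `B`
    have hkill : B (w - ι w) = 0 := by
      set u : W := w - ι w with hudef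
      have hιu : ι u = -u := by rw [hudef, map_sub, hιιv, neg_sub]
      have hsplit : u = (2 : ℂ)⁻¹ • (u + Θ u) + (2 : ℂ)⁻¹ • (u - Θ u) := by module
      have hfix : Θ ((2 : ℂ)⁻¹ • (u + Θ u)) = (2 : ℂ)⁻¹ • (u + Θ u) := by
        rw [map_smul, map_add, hΘΘv, add_comm]
      have hιΘv : ∀ v, ι (Θ v) = Θ (ι v) := fun v => by rw [← Module.End.mul_apply, hιΘ, Module.End.mul_apply]
      have hq1 : ι ((2 : ℂ)⁻¹ • (u - Θ u)) = -((2 : ℂ)⁻¹ • (u - Θ u)) := by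
        rw [map_smul, map_sub, hιΘv, hιu, map_neg]; module
      have hq2 : Θ ((2 : ℂ)⁻¹ • (u - Θ u)) = -((2 : ℂ)⁻¹ • (u - Θ u)) := by
        rw [map_smul, map_sub, hΘΘv]; module
      have hqmem : (2 : ℂ)⁻¹ • (u - Θ u) ∈ Q ⊓ LinearMap.ker B := (hQM _).2 ⟨hq1, hq2⟩
      rw [hsplit, map_add, hkillP B hBΘ _ hfix, zero_add]
      exact LinearMap.mem_ker.1 (Submodule.mem_inf.1 hqmem).2
    rw [map_sub, sub_eq_zero] at hkill
    exact hkill.symm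
  -- `B(W) = B(QU)`
  have hrangeB : ∀ x ∈ LinearMap.range B, x ∈ QU.map B := by
    rintro _ ⟨w, rfl⟩
    exact ⟨_, hQUpart w, (hfactor B hBΘ hBι w).symm⟩
  -- `B` is injective on `QU`
  have hBinj : ∀ a ∈ QU, B a = 0 → a = 0 := fun a ha hBa => by
    obtain ⟨hιa, hΘa⟩ := (hQU a).1 ha
    have hmem : a ∈ Q ⊓ LinearMap.ker B := Submodule.mem_inf.2 ⟨(hQ a).2 hΘa, LinearMap.mem_ker.2 hBa⟩
    have hιa' := ((hQM a).1 hmem).1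
    rw [hιa] at hιa'
    exact htwo a hιa'
  have hQUne : QU ≠ ⊥ := fun h => by
    rw [h, finrank_bot] at hfinQU; omega
  -- grading identities for a raising `Y`
  have hgrade : ∀ Y : Module.End ℂ W, Θ * Y = Y → Y * Θ = -Y →
      Θ * (ι * Y) = ι * Y ∧ ι * Y * Θ = -(ι * Y) ∧ Θ * (Y * ι) = Y * ι ∧ Y * ι * Θ = -(Y * ι) ∧
        Θ * (ι * Y * ι) = ι * Y * ι ∧ ι * Y * ι * Θ = -(ι * Y * ι) := fun Y hΘY hYΘ => by
    refine ⟨?_, ?_, ?_, ?_, ?_, ?_⟩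
    · rw [← mul_assoc, ← hιΘ, mul_assoc, hΘY]
    · rw [mul_assoc, hYΘ, mul_neg]
    · rw [← mul_assoc, hΘY]
    · rw [mul_assoc, hιΘ, ← mul_assoc, hYΘ, neg_mul]
    · rw [← mul_assoc, ← mul_assoc, ← hιΘ, mul_assoc ι Θ Y, hΘY]
    · rw [mul_assoc, hιΘ, ← mul_assoc, mul_assoc ι Y Θ, hYΘ, mul_neg, neg_mul]
  refine ⟨Fin.cons B G, fun i => ?_, fun Y hY hΘY hYΘ => ?_⟩
  · refine Fin.cases ?_ (fun j => ?_) i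
    · simp only [Fin.cons_zero]; exact ⟨hB, hΘB, hBΘ⟩
    · simp only [Fin.cons_succ]; exact ⟨(hG j).1, (hG j).2.1, (hG j).2.2.1⟩
  obtain ⟨h1, h2, h3, h4, h5, h6⟩ := hgrade Y hΘY hYΘ
  -- the three pieces
  set Y₀ : Module.End ℂ W := (2 : ℂ)⁻¹ • (Y + ι * Y * ι) with hY₀def
  set Ya : Module.End ℂ W := (4 : ℂ)⁻¹ • (Y - ι * Y + Y * ι - ι * Y * ι) with hYadef
  set Yb : Module.End ℂ W := (4 : ℂ)⁻¹ • (Y + ι * Y - Y * ι - ι * Y * ι) with hYbdef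
  clear_value Y₀ Ya Yb
  have hdecomp : Y = Y₀ + Ya + Yb := by rw [hY₀def, hYadef, hYbdef]; module
  have hYbmem : Yb ∈ 𝔊 := by rw [hYbdef]; exact UnitaryTheta.raise_mem hbr hι hιιv hY
  have hYamem : Ya ∈ 𝔊 := by
    have h := UnitaryTheta.raise_mem hbr (Submodule.neg_mem _ hι) (fun v => by
      rw [LinearMap.neg_apply, LinearMap.neg_apply, map_neg, neg_neg, hιιv]) hY
    have heq : (4 : ℂ)⁻¹ • (Y + -ι * Y - Y * -ι - -ι * Y * -ι) = Ya := by
      rw [hYadef, neg_mul, neg_mul, mul_neg, mul_neg, neg_neg]; congr 1; abel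
    rw [heq] at h; exact h
  have hY₀mem : Y₀ ∈ 𝔊 := by
    rw [hY₀def]; exact Submodule.smul_mem _ _ (Submodule.add_mem _ hY (UnitaryRaisingDim.conj_mem hbr hι hιι hY))
  have hΘY₀ : Θ * Y₀ = Y₀ := by rw [hY₀def, mul_smul_comm, mul_add, hΘY, h5]
  have hY₀Θ : Y₀ * Θ = -Y₀ := by rw [hY₀def, smul_mul_assoc, add_mul, hYΘ, h6, ← neg_add, smul_neg]
  have hY₀c : Y₀ * ι = ι * Y₀ := by
    rw [hY₀def, smul_mul_assoc, mul_smul_comm, add_mul, mul_add, show ι * Y * ι * ι = ι * Y by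
      rw [mul_assoc, hιι, mul_one], show ι * (ι * Y * ι) = Y * ι by rw [← mul_assoc, ← mul_assoc, hιι, one_mul],
      add_comm]
  have hΘYa : Θ * Ya = Ya := by rw [hYadef, mul_smul_comm, mul_sub, mul_add, mul_sub, hΘY, h1, h3, h5]
  have hYaΘ : Ya * Θ = -Ya := by
    rw [hYadef, smul_mul_assoc, sub_mul, add_mul, sub_mul, hYΘ, h2, h4, h6, ← smul_neg]; congr 1; abel
  have hΘYb : Θ * Yb = Yb := by rw [hYbdef, mul_smul_comm, mul_sub, mul_sub, mul_add, hΘY, h1, h3, h5]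
  have hYbΘ : Yb * Θ = -Yb := by
    rw [hYbdef, smul_mul_assoc, sub_mul, sub_mul, add_mul, hYΘ, h2, h4, h6, ← smul_neg]; congr 1; abel
  have hιιY : ι * (ι * Y) = Y := by rw [← mul_assoc, hιι, one_mul]
  have hιιYι : ι * (ι * Y * ι) = Y * ι := by rw [← mul_assoc, ← mul_assoc, hιι, one_mul]
  have hYιι : Y * ι * ι = Y := by rw [mul_assoc, hιι, mul_one]
  have hιYιι : ι * Y * ι * ι = ι * Y := by rw [mul_assoc, hιι, mul_one]
  have hιYa : ι * Ya = -Ya := by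
    rw [hYadef, mul_smul_comm, mul_sub, mul_add, mul_sub, hιιY, ← mul_assoc ι Y ι, hιιYι, ← smul_neg]
    congr 1; abel
  have hYaι : Ya * ι = Ya := by
    rw [hYadef, smul_mul_assoc, sub_mul, add_mul, sub_mul, hYιι, hιYιι]; congr 1; abel
  have hιYb : ι * Yb = Yb := by
    rw [hYbdef, mul_smul_comm, mul_sub, mul_sub, mul_add, hιιY, ← mul_assoc ι Y ι, hιιYι]; congr 1; abel
  have hYbι : Yb * ι = -Yb := by
    rw [hYbdef, smul_mul_assoc, sub_mul, sub_mul, add_mul, hYιι, hιYιι, ← smul_neg]; congr 1; abel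
  -- Step A: `Yb = 0`
  have hYb0 : Yb = 0 := by
    set Z : Module.End ℂ W := B + Yb with hZdef
    have hZmem : Z ∈ 𝔊 := Submodule.add_mem _ hB hYbmem
    have hΘZ : Θ * Z = Z := by rw [hZdef, mul_add, hΘB, hΘYb]
    have hZΘ : Z * Θ = -Z := by rw [hZdef, add_mul, hBΘ, hYbΘ, neg_add]
    have hBle : LinearMap.range B ≤ LinearMap.range Z := by
      rintro _ ⟨w, rfl⟩
      refine ⟨(2 : ℂ)⁻¹ • (w + ι w), ?_⟩
      have hv : Z (w + ι w) = (2 : ℂ) • B w := by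
        rw [hZdef, LinearMap.add_apply, map_add, map_add, ← Module.End.mul_apply B ι, hBι,
          ← Module.End.mul_apply Yb ι, hYbι, LinearMap.neg_apply, two_smul]; abel
      rw [map_smul, hv, smul_smul, inv_mul_cancel₀ two_ne_zero, one_smul]
    have hYble : LinearMap.range Yb ≤ LinearMap.range Z := by
      rintro _ ⟨w, rfl⟩
      refine ⟨(2 : ℂ)⁻¹ • (w - ι w), ?_⟩
      have hv : Z (w - ι w) = (2 : ℂ) • Yb w := by
        rw [hZdef, LinearMap.add_apply, map_sub, map_sub, ← Module.End.mul_apply B ι, hBι,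
          ← Module.End.mul_apply Yb ι, hYbι, LinearMap.neg_apply, two_smul]; abel
      rw [map_smul, hv, smul_smul, inv_mul_cancel₀ two_ne_zero, one_smul]
    have hZle : LinearMap.range Z ≤ LinearMap.range B ⊔ LinearMap.range Yb := by
      rintro _ ⟨w, rfl⟩
      rw [hZdef, LinearMap.add_apply]
      exact Submodule.add_mem _ (Submodule.mem_sup_left ⟨w, rfl⟩) (Submodule.mem_sup_right ⟨w, rfl⟩)
    have hdisj : LinearMap.range B ⊓ LinearMap.range Yb = ⊥ := by
      refine (Submodule.eq_bot_iff _).2 fun x hx => ?_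
      obtain ⟨hxB, ⟨w, rfl⟩⟩ := Submodule.mem_inf.1 hx
      have hm : ι (Yb w) = -(Yb w) := ((hPM _).1 hxB).1
      have hp : ι (Yb w) = Yb w := by rw [← Module.End.mul_apply, hιYb]
      rw [hp] at hm
      exact htwo _ hm
    have hsup := Submodule.finrank_sup_add_finrank_inf_eq (LinearMap.range B) (LinearMap.range Yb)
    rw [hdisj, finrank_bot, add_zero] at hsup
    have hZeq : LinearMap.range Z = LinearMap.range B ⊔ LinearMap.range Yb :=
      le_antisymm hZle (sup_le hBle hYble)
    have hrk : Module.finrank ℂ (LinearMap.range Z) =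
        Module.finrank ℂ (LinearMap.range B) + Module.finrank ℂ (LinearMap.range Yb) := by rw [hZeq, hsup]
    have h0 : Module.finrank ℂ (LinearMap.range Yb) = 0 := by
      rcases hS Z hZmem hΘZ hZΘ with h | h <;> omega
    exact LinearMap.range_eq_bot.1 (Submodule.finrank_eq_zero.1 h0)
  -- Step B: `Ya = c • B`
  have hmapYa : QU.map Ya ≤ QU.map B := by
    rintro _ ⟨a, -, rfl⟩
    refine hrangeB _ ((hPM _).2 ⟨?_, ?_⟩)
    · rw [← Module.End.mul_apply, hιYa, LinearMap.neg_apply]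
    · rw [← Module.End.mul_apply, hΘYa]
  have hpencil : ∀ c : ℂ, (∀ a ∈ QU, (Ya - c • B) a = 0) ∨ (∀ a ∈ QU, (Ya - c • B) a = 0 → a = 0) := by
    intro c
    set Zc : Module.End ℂ W := Ya - c • B with hZcdef
    have hZcmem : Zc ∈ 𝔊 := Submodule.sub_mem _ hYamem (Submodule.smul_mem _ _ hB)
    have hΘZc : Θ * Zc = Zc := by rw [hZcdef, mul_sub, mul_smul_comm, hΘYa, hΘB]
    have hZcΘ : Zc * Θ = -Zc := by rw [hZcdef, sub_mul, smul_mul_assoc, hYaΘ, hBΘ, smul_neg, neg_sub_neg, neg_sub]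
    have hZcι : Zc * ι = Zc := by rw [hZcdef, sub_mul, smul_mul_assoc, hYaι, hBι]
    rcases hS Zc hZcmem hΘZc hZcΘ with h | h
    · left
      have hZc0 : Zc = 0 := LinearMap.range_eq_bot.1 (Submodule.finrank_eq_zero.1 h)
      intro a _; rw [hZc0, LinearMap.zero_apply]
    · right
      -- `Zc` has rank `dim QU` and factors through `QU`: it is injective on `QU`
      have hrange : LinearMap.range Zc = QU.map Zc := by
        refine le_antisymm ?_ (LinearMap.map_le_range)
        rintro _ ⟨w, rfl⟩
        exact ⟨_, hQUpart w, (hfactor Zc hZcΘ hZcι w).symm⟩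
      have hrd : LinearMap.range (Zc.domRestrict QU) = QU.map Zc := by
        rw [LinearMap.domRestrict, LinearMap.range_comp, Submodule.range_subtype]
      have hrn := LinearMap.finrank_range_add_finrank_ker (Zc.domRestrict QU)
      rw [hrd, ← hrange, h, ← hfinQU] at hrn
      have hker : LinearMap.ker (Zc.domRestrict QU) = ⊥ := Submodule.finrank_eq_zero.1 (by omega)
      intro a ha hZa
      have hmem : (⟨a, ha⟩ : QU) ∈ LinearMap.ker (Zc.domRestrict QU) := by
        rw [LinearMap.mem_ker, LinearMap.domRestrict_apply]; exact hZa
      rw [hker, Submodule.mem_bot] at hmem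
      exact congrArg Subtype.val hmem
  obtain ⟨c, hc⟩ := UnitaryInvertiblePencil.exists_eq_smul_on hQUne hBinj hmapYa hpencil
  have hYaB : Ya = c • B := by
    refine LinearMap.ext fun w => ?_
    rw [hfactor Ya hYaΘ hYaι w, LinearMap.smul_apply, hfactor B hBΘ hBι w]
    exact hc _ (hQUpart w)
  -- conclusion
  have hY₀span : Y₀ ∈ Submodule.span ℂ (Set.range (Fin.cons B G : Fin (k + 1) → Module.End ℂ W)) := by
    refine Submodule.span_mono ?_ (hspan Y₀ hY₀mem hΘY₀ hY₀Θ hY₀c)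
    rintro _ ⟨j, rfl⟩
    exact ⟨j.succ, by simp only [Fin.cons_succ]⟩
  have hBspan : B ∈ Submodule.span ℂ (Set.range (Fin.cons B G : Fin (k + 1) → Module.End ℂ W)) :=
    Submodule.subset_span ⟨0, by simp only [Fin.cons_zero]⟩
  rw [hdecomp, hYb0, add_zero, hYaB]
  exact Submodule.add_mem _ hY₀span (Submodule.smul_mem _ _ hBspan)

/-! ### §4 A full Levi algebra of type `(p | q)` needs `pq` raising elements; padding -/

/-- **Full algebras are not spanned by fewer than `pq` raising elements.** If `L = End(V)` (type `(p | q)`: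
`V = P_V ⊕ Q_V` the eigenspaces of the involution `ι_V`), then no `k < pq` raising elements span the raising elements
of `L`: `f ↦ ι_P ∘ f ∘ π_Q` embeds `Hom(Q_V, P_V)`, of dimension `pq`, into them.
[cite: HoffmanKunze1971LinearAlgebra, §3.1 Thm. 2, §6.7] [cite: GoodmanWallachGTM255, §4.1.1] -/
theorem UnitaryRaisingDim.false_of_fin_span_of_top {V : Type*} [AddCommGroup V] [Module ℂ V]
    [FiniteDimensional ℂ V] {L : Submodule ℂ (Module.End ℂ V)} {ιV : Module.End ℂ V} (hιι : ιV * ιV = 1)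
    {PV QV : Submodule ℂ V} (hP : ∀ x, x ∈ PV ↔ ιV x = x) (hQ : ∀ x, x ∈ QV ↔ ιV x = -x) (htop : L = ⊤)
    {k : ℕ} {F : Fin k → Module.End ℂ V}
    (hspan : ∀ A ∈ L, ιV * A = A → A * ιV = -A → A ∈ Submodule.span ℂ (Set.range F))
    (hk : k < Module.finrank ℂ PV * Module.finrank ℂ QV) : False := by
  classical
  have hιιv : ∀ v, ιV (ιV v) = v := fun v => by rw [← Module.End.mul_apply, hιι, Module.End.one_apply]
  -- the projection onto `Q_V` along `P_V`
  have hπmem : ∀ v, ((2 : ℂ)⁻¹ • (LinearMap.id - ιV) : Module.End ℂ V) v ∈ QV := fun v =>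
    (hQ _).2 (by
      simp only [LinearMap.smul_apply, LinearMap.sub_apply, LinearMap.id_apply, map_smul, map_sub, hιιv]
      module)
  set πQ : V →ₗ[ℂ] QV := LinearMap.codRestrict QV ((2 : ℂ)⁻¹ • (LinearMap.id - ιV)) hπmem with hπQdef
  have hπQval : ∀ v, ((πQ v : QV) : V) = (2 : ℂ)⁻¹ • (v - ιV v) := fun v => by
    rw [hπQdef, LinearMap.codRestrict_apply, LinearMap.smul_apply, LinearMap.sub_apply, LinearMap.id_apply]
  have hπQid : ∀ q : QV, πQ (q : V) = q := fun q => Subtype.ext (by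
    rw [hπQval, (hQ _).1 q.2]; module)
  have hπQι : ∀ v, πQ (ιV v) = -πQ v := fun v => Subtype.ext (by
    rw [Submodule.coe_neg, hπQval, hπQval, hιιv]; module)
  -- the embedding `Φ : Hom(Q_V, P_V) → End V`
  set Φ : (QV →ₗ[ℂ] PV) →ₗ[ℂ] Module.End ℂ V :=
    (LinearMap.llcomp ℂ V PV V PV.subtype).comp (LinearMap.lcomp ℂ PV πQ) with hΦdef
  have hΦapply : ∀ (f : QV →ₗ[ℂ] PV) (v : V), Φ f v = ((f (πQ v) : PV) : V) := fun f v => by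
    rw [hΦdef, LinearMap.comp_apply, LinearMap.llcomp_apply, LinearMap.lcomp_apply, Submodule.subtype_apply]
  have hΦinj : LinearMap.ker Φ = ⊥ := by
    refine (Submodule.eq_bot_iff _).2 fun f hf => ?_
    rw [LinearMap.mem_ker] at hf
    refine LinearMap.ext fun q => Subtype.ext ?_
    have h := hΦapply f (q : V)
    rw [hf, LinearMap.zero_apply, hπQid] at h
    rw [LinearMap.zero_apply, Submodule.coe_zero]
    exact h.symm
  have hΦraise : ∀ f : QV →ₗ[ℂ] PV, ιV * Φ f = Φ f ∧ Φ f * ιV = -(Φ f) := fun f => by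
    refine ⟨LinearMap.ext fun v => ?_, LinearMap.ext fun v => ?_⟩
    · rw [Module.End.mul_apply, hΦapply]
      exact (hP _).1 (f (πQ v)).2
    · rw [Module.End.mul_apply, LinearMap.neg_apply, hΦapply, hΦapply, hπQι, map_neg, Submodule.coe_neg]
  have hrange : LinearMap.range Φ ≤ Submodule.span ℂ (Set.range F) := by
    rintro _ ⟨f, rfl⟩
    exact hspan _ (by rw [htop]; exact Submodule.mem_top) (hΦraise f).1 (hΦraise f).2
  have h1 : Module.finrank ℂ (QV →ₗ[ℂ] PV) = Module.finrank ℂ (LinearMap.range Φ) :=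
    (LinearMap.finrank_range_of_inj (LinearMap.ker_eq_bot.1 hΦinj)).symm
  have h2 := Submodule.finrank_mono hrange
  have h3 : Module.finrank ℂ (Submodule.span ℂ (Set.range F)) ≤ k := by
    have h := finrank_range_le_card (R := ℂ) F
    rw [Set.finrank, Fintype.card_fin] at h
    exact h
  have h4 : Module.finrank ℂ (QV →ₗ[ℂ] PV) = Module.finrank ℂ QV * Module.finrank ℂ PV :=
    Module.finrank_linearMap ℂ ℂ QV PV
  rw [h4] at h1
  rw [Nat.mul_comm] at hk
  omega

/-- Padding a spanning family of raising elements with zeros. [cite: HoffmanKunze1971LinearAlgebra, §2.3] -/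
theorem UnitaryRaisingDim.exists_fin_span_pad {V : Type*} [AddCommGroup V] [Module ℂ V]
    {L : Submodule ℂ (Module.End ℂ V)} {ιV : Module.End ℂ V} {k l : ℕ} (hkl : k ≤ l)
    {F : Fin k → Module.End ℂ V} (hF : ∀ i, F i ∈ L ∧ ιV * F i = F i ∧ F i * ιV = -(F i))
    (hspan : ∀ A ∈ L, ιV * A = A → A * ιV = -A → A ∈ Submodule.span ℂ (Set.range F)) :
    ∃ G : Fin l → Module.End ℂ V, (∀ i, G i ∈ L ∧ ιV * G i = G i ∧ G i * ιV = -(G i)) ∧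
      ∀ A ∈ L, ιV * A = A → A * ιV = -A → A ∈ Submodule.span ℂ (Set.range G) := by
  classical
  refine ⟨fun i => if h : (i : ℕ) < k then F ⟨i, h⟩ else 0, fun i => ?_, fun A hA hιA hAι => ?_⟩
  · by_cases h : (i : ℕ) < k
    · simp only [h, dif_pos]; exact hF _
    · simp only [h, dif_neg, not_false_eq_true]
      exact ⟨Submodule.zero_mem _, mul_zero _, by rw [zero_mul, neg_zero]⟩
  · refine Submodule.span_mono ?_ (hspan A hA hιA hAι)
    rintro _ ⟨j, rfl⟩
    refine ⟨⟨j, lt_of_lt_of_le j.2 hkl⟩, ?_⟩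
    simp only [j.2, dif_pos]

/-- Padding a spanning family of raising operators commuting with `ι` with zeros.
[cite: HoffmanKunze1971LinearAlgebra, §2.3] -/
theorem UnitaryRaisingDim.exists_fin_span_commute_pad {𝔊 : Submodule ℂ (Module.End ℂ W)}
    {Θ ι : Module.End ℂ W} {k l : ℕ} (hkl : k ≤ l) {G : Fin k → Module.End ℂ W}
    (hG : ∀ i, G i ∈ 𝔊 ∧ Θ * G i = G i ∧ G i * Θ = -(G i) ∧ G i * ι = ι * G i)
    (hspan : ∀ X ∈ 𝔊, Θ * X = X → X * Θ = -X → X * ι = ι * X → X ∈ Submodule.span ℂ (Set.range G)) :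
    ∃ G' : Fin l → Module.End ℂ W, (∀ i, G' i ∈ 𝔊 ∧ Θ * G' i = G' i ∧ G' i * Θ = -(G' i) ∧ G' i * ι = ι * G' i) ∧
      ∀ X ∈ 𝔊, Θ * X = X → X * Θ = -X → X * ι = ι * X → X ∈ Submodule.span ℂ (Set.range G') := by
  classical
  refine ⟨fun i => if h : (i : ℕ) < k then G ⟨i, h⟩ else 0, fun i => ?_, fun X hX hΘX hXΘ hXc => ?_⟩
  · by_cases h : (i : ℕ) < k
    · simp only [h, dif_pos]; exact hG _
    · simp only [h, dif_neg, not_false_eq_true]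
      exact ⟨Submodule.zero_mem _, mul_zero _, by rw [zero_mul, neg_zero], by rw [zero_mul, mul_zero]⟩
  · refine Submodule.span_mono ?_ (hspan X hX hΘX hXΘ hXc)
    rintro _ ⟨j, rfl⟩
    refine ⟨⟨j, lt_of_lt_of_le j.2 hkl⟩, ?_⟩
    simp only [j.2, dif_pos]

end HodgeStructure

end Literature.AlgebraicGeometry.Motives
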